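import Summits.ABC.ABC.Theses.DefiniteXi
import Summits.ABC.ABC.Theorems.FreyDegreeBound.Negative.ExponentBelowTwo
import Summits.ABC.ABC.Theorems.FreyDegreeBound.Negative.LevelAndConductor
import Literature.NumberTheory.EllipticCurves.DegreeConjectureAbcMurty
import Literature.NumberTheory.EllipticCurves.ModularDegreeMinimal

/-!
# Disproof of `FreyDegreeBound` (stmt-ABC-2019) — findings of the standing disprover (cdisprove gen 1)

Crux (route `DefiniteXi`, thesis X, auto-crux r0): `FreyDegreeBound` — for every `ε > 0` a `C` with,
for all coprime `a, b`, `ab(a+b) ≠ 0`, `N = conductorNorm ℤ (freyCurve a b)`: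
`∃ D : ModularParametrizationData (freyCurve a b) N, deg D ≤ C · N^{2+ε}`
(Frey's degree conjecture on the Frey–Hellegouarch curves).

**VERDICT (gen 1): RESISTS — and cannot be killed short of disproving abc.**  §1 records the
calibration: modulo the tree's named fact `abcLe_iff_freyDegreeConjecture` (Murty 1999 Thm 1 +
Pasten 2024 Rem 3.3) the crux IS the `≤`-form of abc; direction crux ⟹ abc is a THEOREM of the tree
relative to the Hoffstein–Lockhart Petersson bound (route item `PeterssonLowerBound`), and even
UNCONDITIONALLY the crux gives `c ≪_ε rad(abc)^{3/2+ε}` (`abcLe_threeHalves_of_freyDegreeBound`),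
far beyond anything known (Stewart–Yu: `log c ≪ rad^{1/3}(log rad)³`).  So an unconditional `¬` is a
disproof of abc, and every census below is consistent with the crux.

What the disprover DID establish (all sorry-free, standard axioms; §2–§3 are LANDED under
`Summits/ABC/ABC/Theorems/FreyDegreeBound/Negative/` — `ExponentBelowTwo.lean` (p78160) and
`LevelAndConductor.lean` (p77488) — and imported here; §2' is prepared as `Negative/XiStrongExponent.lean`):

* §2 TIGHTNESS — **the exponent `2` cannot be lowered**: for every `θ < 3/2` UNCONDITIONALLY, and for
  every `θ < 2` under the route's own frame item `PeterssonLowerBound`, there is NO `C` with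
  `deg ≤ C N^θ` for some datum of every Frey curve (`not_freyDegreeBound_exponent_lt_three_halves`,
  `not_freyDegreeBound_exponent_lt_two`).  Masser's 1990 remark "deg φ ≥ N^{2−o(1)} infinitely
  often" is thereby a kernel-checked theorem (modulo the GL(3) input for the last `1/2`): Masser-type
  Frey pairs with the parameters exposed (`exists_frey_pair_excess`: `N⁶ ≤ |Δ_min|`, `N → ∞`) +
  Zagier + `c ≠ 0` + Silverman run backwards (`abs_Δ_le_of_frey_datum`), packaged POINTWISE as
  `deg_gt_on_szpiro_six_pairs` (every datum of every such curve beyond `N₀(C,θ,η)` has `deg > C N^θ`;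
  reusable against exponent-`θ` versions of the sibling cruxes `XiStrongBound`/`XiBound` through
  `DefiniteRTControlPrime` at the odd prime `q ∣ N` the pairs come with — done in §2' for
  `XiStrongBound`: `not_xiStrongBound_exponent_lt_two`, conditional on the route's known supports
  `PeterssonLowerBound`, `DefiniteRTControlPrime`, `FreyModularity`).  The crux asserts every
  exponent `> 2` (`freyDegreeBound_iff_forall_eps`): it sits EXACTLY on the boundary.
* §3 LOAD-BEARING hypotheses: `0 < ε` (`freyDegreeBound_false_without_eps_pos`: `ε = −1` is refuted by
  §2); the level hypothesis `conductorNorm = N` (`freyDegreeBound_false_without_conductor`: at level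
  `1` no datum exists at all, `isEmpty_modularParametrizationData_one`, from Mathlib's `S₂(SL₂(ℤ)) = 0`);
  conductors of Frey curves are unbounded (`conductorNorm_freyCurve_unbounded`).
  NOT load-bearing for truth (only for the route): `IsCoprime a b` — without it `E_{da,db}` is the
  quadratic twist of `E_{a,b}` by `d`, still covered by the general degree conjecture (no refutation
  attempted; any proof along THIS route uses coprimality through `N ∣ 2⁸ rad`).  `ab(a+b) ≠ 0` IS
  load-bearing (`freyDegreeBound_false_without_nonzero`): a singular curve has the junk conductor `1`
  (`conductorNorm_of_Δ_eq_zero`), and level `1` carries no datum.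
* §4 THE ONLY JUNK MODEL: the crux is junk-false in the tree's formalisation iff some Frey curve has
  `conductorNorm ℤ = 1` (`not_freyDegreeBound_of_conductorNorm_eq_one`), and by the proved
  `rad(ab(a+b)) ∣ 2N` that can only be a pair with `|ab(a+b)| = 2^k`
  (`natAbs_eq_two_pow_of_conductorNorm_eq_one`), i.e. the six pairs `(±1,±1), (1,−2), …` — all the
  curve `y² = x³ − x` (Cremona 32a2, conductor `32`, Kodaira III at 2).  The tree's Ogg/Tate
  implementation of `conductorNorm` has not been evaluated on it; provers relying on `FreyModularity`
  need `conductorNorm = 32` there (else no newform of the computed level exists).  Everything else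
  about existence of data is the route item `FreyModularity` (BCDT), deliberately not touched here.
* §5 CENSUS (kit jobs, PARI `ellmoddegree`; evidence files `compute-j…` on the item): see the
  comment block at the end — numbers are filled in as jobs return.
* §6 NOT ATTEMPTED / OPEN: (a) `θ = 2` with a constant (`ε = 0`): Masser's excess is only
  `exp(c√(log N)/log log N)`, below the `N^{±ε}` losses of the Petersson/Silverman inputs — undecided;
  (b) the `∀ D` misreading ("every datum has small degree") is junk-false by pumping the Manin
  constant (`c ↦ 2c` multiplies `deg` by `4`), needs the fibre count of `[2] ∘ φ` — not formalised;
  (c) no finite computation can refute an `∀ ε ∃ C` statement; the census only calibrates `C(ε)`.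

Attacks tried (gen 1), one line each: definitional audit of `ModularParametrizationData`
(f pinned by multiplicity one, `L`/`uniformize` pinned by the model, `c ∈ c₀ℤ`, `deg` pinned by
`deg_spec`; minimal `deg` = optimal degree × isogeny index × `u²`-factor `≤ 4` from the non-minimal
Frey model — genuinely the degree conjecture) · Mathlib `WeierstrassCurve.LFunction` is
model-independent (`W.minimal R` at each place), so `IsNewformOf (freyCurve a b) f` is satisfiable
iff the computed level is the true conductor · level-one vacuity (§3) · Masser/Szpiro-ratio families
(§2) · literature negatives: `ledger negatives --problem ABC` (2 entries, unrelated), barrier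
catalogue `SzpiroEpsilonCannotBeDropped` (PROVED in tree; used constructively in §2),
`EpsilonCannotBeDropped`, `BakerMethodBounds` (benchmark only).
-/

noncomputable section

set_option linter.dupNamespace false

open scoped MatrixGroups
open IsDedekindDomain WeierstrassCurve NumberField
open Literature.NumberTheory.DiophantineGeometry Literature.NumberTheory.EllipticCurves
  UniqueFactorizationMonoid Literature.Barriers.ABC Literature.Barriers.ABC.Masser
open Literature.NumberTheory.EllipticCurves.ModularForms CongruenceSubgroup
open Summit.ABC.ABC.Theses.DefiniteXi
open Summit.ABC.ABC.Theorems.FreyDegreeBound.Negative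

namespace Summit.ABC.ABC.Cruxes.FreyDegreeBound.Disproof

/-! ## §0 The crux with a free exponent -/

/-- The crux with a FIXED real exponent `θ` in place of `2 + ε` (one constant `C`). -/
def FreyDegreeBoundExp (θ : ℝ) : Prop :=
  ∃ C : ℝ, ∀ a b : ℤ, IsCoprime a b → a * b * (a + b) ≠ 0 → ∀ (N : ℕ) [NeZero N],
    (freyCurve a b).conductorNorm ℤ = N →
      ∃ D : ModularParametrizationData (freyCurve a b) N, (D.deg : ℝ) ≤ C * (N : ℝ) ^ θ

/-- `FreyDegreeBound ↔ ∀ ε > 0, FreyDegreeBoundExp (2 + ε)` (by `rfl`). -/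
theorem freyDegreeBound_iff_forall_exp :
    FreyDegreeBound ↔ ∀ ε : ℝ, 0 < ε → FreyDegreeBoundExp (2 + ε) :=
  Iff.rfl

/-! ## §1 Calibration: the crux is abc on Frey curves -/

/-- Modulo Murty's Theorem 1 (tree named fact `abcLe_iff_freyDegreeConjecture`, Murty 1999 +
Pasten 2024 Rem. 3.3) the crux is LITERALLY the `≤`-form of the abc conjecture. Consequently an
unconditional `¬ FreyDegreeBound` would be `¬ abc`. -/
theorem freyDegreeBound_iff_abcLe (h : abcLe_iff_freyDegreeConjecture) :
    FreyDegreeBound ↔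
      ∀ ε : ℝ, 0 < ε → ∃ C : ℝ, ∀ a b c : ℕ, IsABCTriple a b c →
        (c : ℝ) ≤ C * ((rad a b c : ℕ) : ℝ) ^ (1 + ε) :=
  h.symm

/-- Direction crux ⟹ `ABC` is a theorem of the tree relative to the route item
`PeterssonLowerBound` (Hoffstein–Lockhart): the planners' one-liner for `DegreeBoundToABCOfPetersson`. -/
theorem abc_of_freyDegreeBound (hP : PeterssonLowerBound) (h : FreyDegreeBound) : _root_.ABC :=
  abcLt_of_freyDegreeBound hP silverman1986_discriminant_c4_covolume_holds h

/-- UNCONDITIONALLY the crux already yields `c ≤ C_ε · rad(abc)^{3/2+ε}` (tree theorem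
`abcLe_threeHalves_of_freyDegreeConjecture`, via the elementary `(f,f) ≫ N^{1/2−ε}`) — a polynomial
abc far beyond Stewart–Yu; a measure of how strong any proof of the crux must be. -/
theorem abcLe_threeHalves_of_freyDegreeBound (h : FreyDegreeBound) :
    ∀ ε : ℝ, 0 < ε → ∃ C : ℝ, ∀ a b c : ℕ, IsABCTriple a b c →
      (c : ℝ) ≤ C * ((rad a b c : ℕ) : ℝ) ^ (3 / 2 + ε) :=
  abcLe_threeHalves_of_freyDegreeConjecture h

/-- Converse direction relative to its inputs (Murty Thm 1 (ii); tree theorem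
`abcLe_imp_freyDegreeConjecture_of_petersson_of_manin`): abc + the Petersson UPPER bound
`(f,f) ≪_η N^{1+η}` + Frey data with bounded Manin constant (modularity + Pasten Thm 1.3) ⟹ crux. -/
theorem freyDegreeBound_of_abcLe
    (hUp : ∀ η : ℝ, 0 < η → ∃ C₂ : ℝ, ∀ (N : ℕ) [NeZero N] (W : WeierstrassCurve ℚ) [W.IsElliptic]
      (f : CuspForm (Gamma0 N) 2), IsNewformOf W f →
        (peterssonProduct (Gamma0 N) 2 f f).re ≤ C₂ * (N : ℝ) ^ (1 + η))
    (hM : ∃ M : ℕ, ∀ a b : ℤ, IsCoprime a b → a * b * (a + b) ≠ 0 →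
      ∀ (N : ℕ) [NeZero N], (freyCurve a b).conductorNorm ℤ = N →
        ∃ D : ModularParametrizationData (freyCurve a b) N, D.maninConstant.natAbs ≤ M)
    (habc : ∀ ε : ℝ, 0 < ε → ∃ C : ℝ, ∀ a b c : ℕ, IsABCTriple a b c →
      (c : ℝ) ≤ C * ((rad a b c : ℕ) : ℝ) ^ (1 + ε)) :
    FreyDegreeBound :=
  abcLe_imp_freyDegreeConjecture_of_petersson_of_manin hUp hM habc

/-! ## §2 Tightness: the exponent `2` cannot be lowered (LANDED: `Negative.ExponentBelowTwo`, p78160)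

Kernel-checked pointers to the landed theorems (namespace
`Summit.ABC.ABC.Theorems.FreyDegreeBound.Negative`), restated through `FreyDegreeBoundExp`. -/

/-- Masser-type Frey pairs with parameters exposed: `N > N₀`, `2⁸N⁶ ≤ (AB(A+B))²`, odd prime `q ∣ N`. -/
example (N₀ : ℕ) : ∃ A B : ℤ, IsCoprime A B ∧ A * B * (A + B) ≠ 0 ∧ A ≡ -1 [ZMOD 4] ∧ (32 : ℤ) ∣ B ∧
    N₀ < (freyCurve A B).conductorNorm ℤ ∧
    2 ^ 8 * ((freyCurve A B).conductorNorm ℤ) ^ 6 ≤ (A * B * (A + B)).natAbs ^ 2 ∧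
    ∃ q : ℕ, q.Prime ∧ 2 < q ∧ q ∣ (freyCurve A B).conductorNorm ℤ :=
  exists_frey_pair_excess N₀

/-- UNCONDITIONALLY no exponent `θ < 3/2` (Iwaniec/H–L `(f,f) ≫ N^{1/2−ε}` of the tree). -/
theorem not_freyDegreeBoundExp_of_lt_three_halves {θ : ℝ} (hθ : θ < 3 / 2) :
    ¬ FreyDegreeBoundExp θ :=
  not_freyDegreeBound_exponent_lt_three_halves hθ

/-- Under the route item `PeterssonLowerBound` no exponent `θ < 2` — while the crux is `∀ θ > 2`. -/
theorem not_freyDegreeBoundExp_of_lt_two (hP : PeterssonLowerBound) {θ : ℝ} (hθ : θ < 2) :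
    ¬ FreyDegreeBoundExp θ :=
  not_freyDegreeBound_exponent_lt_two hP hθ

/-- POINTWISE form: under `(f,f) ≫ N^{1−η}` and `θ < 2 − η`, for ANY `C`, every datum of every
Masser-type pair beyond `N₀(C,θ,η)` has `deg > C · N^θ` (`deg_gt_on_szpiro_six_pairs`). -/
example {η θ : ℝ} (hθ : θ < 2 - η)
    (hPη : ∃ c₂ : ℝ, 0 < c₂ ∧ ∀ (N : ℕ) [NeZero N] (W : WeierstrassCurve ℚ) [W.IsElliptic]
      (D : ModularParametrizationData W N),
      c₂ * (N : ℝ) ^ (1 - η) ≤ (peterssonProduct (Gamma0 N) 2 D.f D.f).re) (C₀ : ℝ) :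
    ∃ N₀ : ℕ, ∀ A B : ℤ, IsCoprime A B → A * B * (A + B) ≠ 0 → A ≡ -1 [ZMOD 4] → (32 : ℤ) ∣ B →
      N₀ < (freyCurve A B).conductorNorm ℤ →
      2 ^ 8 * ((freyCurve A B).conductorNorm ℤ) ^ 6 ≤ (A * B * (A + B)).natAbs ^ 2 →
      ∀ (N : ℕ) [NeZero N], (freyCurve A B).conductorNorm ℤ = N →
        ∀ D : ModularParametrizationData (freyCurve A B) N, C₀ * (N : ℝ) ^ θ < D.deg :=
  deg_gt_on_szpiro_six_pairs hθ hPη C₀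

/-- Load-bearing `0 < ε`: the crux over ALL real `ε` is false (`ε = −1` refuted by §2). -/
example : ¬ ∀ ε : ℝ, ∃ C : ℝ, ∀ a b : ℤ, IsCoprime a b → a * b * (a + b) ≠ 0 → ∀ (N : ℕ) [NeZero N],
    (freyCurve a b).conductorNorm ℤ = N →
      ∃ D : ModularParametrizationData (freyCurve a b) N, (D.deg : ℝ) ≤ C * (N : ℝ) ^ (2 + ε) :=
  freyDegreeBound_false_without_eps_pos

/-- The weak rung `PolyFreyDegree` (stmt-ABC-2026: `∃ A C, deg ≤ C N^A`) can only hold with `A ≥ 3/2`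
(unconditionally) — its witness exponent is pinned to `[3/2, ∞)`, resp. `[2, ∞)` under
`PeterssonLowerBound`. -/
theorem polyFreyDegree_exponent_ge_three_halves (h : PolyFreyDegree) :
    ∃ A C : ℝ, 3 / 2 ≤ A ∧ ∀ a b : ℤ, IsCoprime a b → a * b * (a + b) ≠ 0 → ∀ (N : ℕ) [NeZero N],
      (freyCurve a b).conductorNorm ℤ = N →
        ∃ D : ModularParametrizationData (freyCurve a b) N, (D.deg : ℝ) ≤ C * (N : ℝ) ^ A := by
  obtain ⟨A, C, hAC⟩ := h
  refine ⟨A, C, ?_, hAC⟩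
  by_contra hA
  exact not_freyDegreeBound_exponent_lt_three_halves (not_le.mp hA) ⟨C, hAC⟩

/-! ## §2' The sibling crux `XiStrongBound` (stmt-ABC-11337) inherits the sharpness
(prepared for landing as `Negative/XiStrongExponent.lean`) -/

/-- **The sibling crux `XiStrongBound` is equally sharp (conditional on the route's known supports).**
Under `PeterssonLowerBound` (Hoffstein–Lockhart), `DefiniteRTControlPrime` (the definite
Ribet–Takahashi comparison, known) and `FreyModularity` (BCDT), for every `θ < 2` there is no `C`
with `ξ(E; N/N⁻, N⁻) · ∏_{q ∣ N⁻} v_q(Δ_min) ≤ C · N^θ` for all Frey curves and all admissible `N⁻`: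
at `N⁻ = q`, the odd prime the Masser pairs come with, the RT comparison turns such a bound into
`deg D_min ≤ C' N^{θ+ε}` for a minimal datum, excluded by `deg_gt_on_szpiro_six_pairs`. -/
theorem not_xiStrongBound_exponent_lt_two
    (hP : Summit.ABC.ABC.Theses.DefiniteXi.PeterssonLowerBound)
    (hRT : Summit.ABC.ABC.Theses.DefiniteXi.DefiniteRTControlPrime)
    (hMod : Summit.ABC.ABC.Theses.DefiniteXi.FreyModularity) {θ : ℝ} (hθ : θ < 2) :
    ¬ ∃ C : ℝ, ∀ a b : ℤ, IsCoprime a b → a * b * (a + b) ≠ 0 → ∀ (N : ℕ) [NeZero N],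
      (freyCurve a b).conductorNorm ℤ = N → ∀ Nm : ℕ, Odd Nm → Squarefree Nm →
        Odd Nm.primeFactors.card → Nm ∣ N →
          (Literature.NumberTheory.Automorphic.brandtXi (N / Nm) Nm
              (fun n => (freyCurve a b).LFunction n) : ℝ) *
            ∏ q ∈ Nm.primeFactors,
              ((((freyCurve a b).minimalDiscriminantNorm ℤ).factorization q : ℕ) : ℝ) ≤
          C * (N : ℝ) ^ θ := by
  rintro ⟨C, hC⟩
  set ε : ℝ := (2 - θ) / 2 with hε
  have hε0 : 0 < ε := by rw [hε]; linarith
  obtain ⟨C₂, hC₂⟩ := hRT ε hε0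
  set η : ℝ := (2 - (θ + ε)) / 2 with hη
  have hη0 : 0 < η := by rw [hη, hε]; linarith
  obtain ⟨c, hc, hcN⟩ := hP η hη0
  have hPη : ∃ c₂ : ℝ, 0 < c₂ ∧ ∀ (N : ℕ) [NeZero N] (W : WeierstrassCurve ℚ) [W.IsElliptic]
      (D : ModularParametrizationData W N),
      c₂ * (N : ℝ) ^ (1 - η) ≤ (peterssonProduct (Gamma0 N) 2 D.f D.f).re :=
    ⟨c, hc, fun N _ W _ D ↦ hcN N W D.f D.isNewformOf⟩
  obtain ⟨N₀, hN₀⟩ :=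
    deg_gt_on_szpiro_six_pairs (θ := θ + ε) (by rw [hη]; linarith) hPη (max C₂ 0 * max C 0)
  obtain ⟨A, B, hAB, h0, hA, hB, hN, hexcess, q, hq, hq2, hqN⟩ := exists_frey_pair_excess N₀
  haveI := isElliptic_freyCurve h0
  set N : ℕ := (freyCurve A B).conductorNorm ℤ with hNdef
  have hNpos : 0 < N := conductorNorm_pos_holds (freyCurve A B)
  haveI : NeZero N := ⟨hNpos.ne'⟩
  have hNr : (0 : ℝ) < N := by exact_mod_cast hNpos
  -- a minimal datum (modularity) and the RT comparison at the odd prime `q`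
  obtain ⟨D, -, hDmin⟩ := exists_minimal_datum (hMod A B hAB h0 N hNdef.symm)
  have hq' : q ≠ 2 := by omega
  have hRTD := hC₂ A B hAB h0 N hNdef.symm q hq hq' hqN D (fun D' ↦ hDmin D')
  -- the `ξ`-bound at `N⁻ = q`
  have hodd : Odd q := hq.odd_of_ne_two hq'
  have hpf : q.primeFactors = {q} := hq.primeFactors
  have hcard : Odd q.primeFactors.card := by rw [hpf]; simp
  have hξ := hC A B hAB h0 N hNdef.symm q hodd hq.squarefree hcard hqN
  rw [hpf, Finset.prod_singleton] at hξ
  -- combine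
  set X : ℝ := (Literature.NumberTheory.Automorphic.brandtXi (N / q) q
      (fun n => (freyCurve A B).LFunction n) : ℝ) *
    ((((freyCurve A B).minimalDiscriminantNorm ℤ).factorization q : ℕ) : ℝ) with hX
  have hX0 : 0 ≤ X := by positivity
  have he1 : 0 ≤ (N : ℝ) ^ ε := by positivity
  have he2 : 0 ≤ (N : ℝ) ^ θ := by positivity
  have hdegle : (D.deg : ℝ) ≤ max C₂ 0 * max C 0 * (N : ℝ) ^ (θ + ε) := by
    calc (D.deg : ℝ) ≤ C₂ * (N : ℝ) ^ ε * X := hRTD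
      _ ≤ max C₂ 0 * (N : ℝ) ^ ε * X := by gcongr; exact le_max_left _ _
      _ ≤ max C₂ 0 * (N : ℝ) ^ ε * (max C 0 * (N : ℝ) ^ θ) := by
          gcongr
          exact hξ.trans (mul_le_mul_of_nonneg_right (le_max_left _ _) he2)
      _ = max C₂ 0 * max C 0 * ((N : ℝ) ^ θ * (N : ℝ) ^ ε) := by ring
      _ = max C₂ 0 * max C 0 * (N : ℝ) ^ (θ + ε) := by rw [← Real.rpow_add hNr]
  exact absurd hdegle (not_le.mpr (hN₀ A B hAB h0 hA hB hN hexcess N hNdef.symm D))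


/-! ## §3 Load-bearing hypotheses: level and non-degeneracy (LANDED: `Negative.LevelAndConductor`, p77488) -/

/-- No modular parametrisation datum at level `1` (`S₂(Γ₀(1)) = 0`). -/
example (W : WeierstrassCurve ℚ) : IsEmpty (ModularParametrizationData W 1) :=
  isEmpty_modularParametrizationData_one W

/-- Load-bearing: the level must be the conductor. -/
example : ¬ ∀ ε : ℝ, 0 < ε → ∃ C : ℝ, ∀ a b : ℤ, IsCoprime a b → a * b * (a + b) ≠ 0 →
    ∀ (N : ℕ) [NeZero N], ∃ D : ModularParametrizationData (freyCurve a b) N,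
      (D.deg : ℝ) ≤ C * (N : ℝ) ^ (2 + ε) :=
  freyDegreeBound_false_without_conductor

/-- Load-bearing: `ab(a+b) ≠ 0` (a singular curve has the junk conductor `1`). -/
example : ¬ ∀ ε : ℝ, 0 < ε → ∃ C : ℝ, ∀ a b : ℤ, IsCoprime a b →
    ∀ (N : ℕ) [NeZero N], (freyCurve a b).conductorNorm ℤ = N →
      ∃ D : ModularParametrizationData (freyCurve a b) N, (D.deg : ℝ) ≤ C * (N : ℝ) ^ (2 + ε) :=
  freyDegreeBound_false_without_nonzero

/-- Conductors of Frey curves are unbounded. -/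
example (M : ℕ) : ∃ a b : ℤ, IsCoprime a b ∧ a * b * (a + b) ≠ 0 ∧ M < (freyCurve a b).conductorNorm ℤ :=
  conductorNorm_freyCurve_unbounded M

/-! ## §4 The only junk model -/

/-- **The only junk model.** If some Frey curve (coprime `a, b`, `ab(a+b) ≠ 0`) had
`conductorNorm ℤ = 1` in the tree's Ogg–Tate formalisation, the crux would be (junk-)false: no
datum exists at level `1`. (For the intended conductor this never happens: `N_E ≥ 11`.) -/
theorem not_freyDegreeBound_of_conductorNorm_eq_one {a b : ℤ} (hab : IsCoprime a b)
    (h0 : a * b * (a + b) ≠ 0) (hN : (freyCurve a b).conductorNorm ℤ = 1) :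
    ¬ Summit.ABC.ABC.Theses.DefiniteXi.FreyDegreeBound := by
  intro h
  obtain ⟨C, hC⟩ := h 1 one_pos
  obtain ⟨D, -⟩ := hC a b hab h0 1 hN
  exact (isEmpty_modularParametrizationData_one (freyCurve a b)).false D

/-- … and such a junk model can only be one of the six pairs with `|ab(a+b)|` a power of `2`
(all isomorphic to `y² = x³ − x`, Cremona `32a`, true conductor `32`): by the proved
`rad(ab(a+b)) ∣ 2 N` (`radical_natAbs_dvd_two_mul_conductorNorm_freyCurve`), `N = 1` forces every
prime factor of `ab(a+b)` to be `2`. -/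
theorem natAbs_eq_two_pow_of_conductorNorm_eq_one {a b : ℤ} (hab : IsCoprime a b)
    (h0 : a * b * (a + b) ≠ 0) (hN : (freyCurve a b).conductorNorm ℤ = 1) :
    ∃ k : ℕ, (a * b * (a + b)).natAbs = 2 ^ k := by
  have hdvd := radical_natAbs_dvd_two_mul_conductorNorm_freyCurve hab h0
  rw [hN, mul_one] at hdvd
  have hm0 : (a * b * (a + b)).natAbs ≠ 0 := Int.natAbs_ne_zero.mpr h0
  refine ⟨_, Nat.eq_prime_pow_of_unique_prime_dvd hm0 fun {d} hd hdm ↦ ?_⟩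
  have hdr : d ∣ radical (a * b * (a + b)).natAbs :=
    Nat.dvd_of_mem_primeFactors (by rw [Nat.primeFactors_radical]; exact Nat.mem_primeFactors.mpr ⟨hd, hdm, hm0⟩)
  exact (Nat.prime_dvd_prime_iff_eq hd Nat.prime_two).mp (dvd_trans hdr hdvd)


/-! ## §5 Census (PARI/GP 2.15 `ellmoddegree` = analytic Watkins method, value `deg/c²` with `c` the
Manin constant of the curve's own minimal parametrisation; kit jobs attached to the item as evidence)

**j010688** (calibration, 2026-08-16; famous abc triples, all six sign/role arrangements
`(u,v) ∈ {(a,b),(b,a),(a,−c),(−c,a),(b,−c),(−c,b)}` of `y² = x(x−u)(x+v)`, deduplicated by minimal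
model; `N ≤ 6·10⁴` attempted).  Columns: conductor `N`, Szpiro ratio `σ = log|Δ_min|/log N`, the
Zagier–Silverman prediction `1 + σ/6` for `log deg/log N`, the computed `deg` and `log deg / log N`:

| triple | `(u,v)` | `N` | `σ` | `1+σ/6` | `deg` | `log deg/log N` |
|---|---|---|---|---|---|---|
| de Weger `11² + 3²5⁶7³ = 2²¹·23` | `(121, 48234375)` | `53130` | `6.88` | `2.15` | `3158507520` | **`2.0103`** |
| `7³ + 3¹⁰ = 2¹¹·29` | `(59049, 343)` | `1218` | `7.05` | `2.17` | `241920` | `1.7447` |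
| `7³ + 3¹⁰ = 2¹¹·29` | `(343, 59049)` | `9744` | `6.36` | `2.06` | `5806080` | `1.6957` |
| `1 + 2·3⁷ = 5⁴·7` | `(1, 4374)` | `3360` | `4.47` | `1.75` | `107520` | `1.4268` |
| `1 + 2400 = 7⁴` | `(1, 2400)` | `1680` | `4.57` | `1.76` | `24576` | `1.3612` |
| `1 + 4095 = 2¹²` | `(4095, 1)` | `21840` | `3.61` | `1.60` | `393216` | `1.2893` |
| `169 + 343 = 2⁹` | `(343, 169)` | `1456` | `5.11` | `1.85` | `8640` | `1.2444` |
| `3 + 125 = 2⁷` | `(3, 125)` | `240` | `4.44` | `1.74` | `288` | `1.0332` |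

Not reached in the calibration run (`N` too large; jobs j013920/j013921 queued with `N ≤ 3·10⁷`):
Reyssat `2 + 3¹⁰109 = 23⁵` (`N = 240672`, `σ = 5.40`, prediction `1.90`), de Weger's other
arrangement (`N = 425040`, `σ = 6.41`), `283 + 5¹¹13² = 2⁸3⁸17³` (`N = 1876290`, `σ = 6.72`, pred.
`2.12`; and `N = 15010320`), `13·19⁶ + 2³⁰5 = 3¹³11²31` (`N = 2526810`, **`σ = 8.46`**, pred. `2.41`;
and `N = 20214480`, `σ = 7.91`), Browkin–Brzeziński (`N ≈ 4.7·10⁹`, `σ = 7.15`), Nitaj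
(`N ≈ 4.6·10¹⁴`, `σ = 7.44`).

READING.  (1) A concrete semistable curve of conductor `53130 = 2·3·5·7·11·23` has modular degree
`≥ 3158507520 > 53130² = 2822796900`: the `ε`-free bound `deg ≤ N²` with constant `1` is FALSE in
nature (of course consistent with the crux, whose `C(ε)` absorbs it; `log deg/log N = 2.0103`).
(2) The observed exponents track `1 + σ/6` from above by `0.1–0.4` (the `L(Sym² f)` edge factor and
`ω(N)`), exactly the mechanism of §2: large Szpiro ratio ⟹ large degree; the record `σ = 8.46` curve
predicts `log deg/log N ≈ 2.4` at `N = 2.5·10⁶` (pending).  (3) Nothing here can refute an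
`∀ ε ∃ C(ε)` statement; the census calibrates how large `C(ε)` must be (`C(0.01) ≥ N^{0.37}`-ish at
`N ∼ 10⁶` if (2) confirms) and corroborates the sharpness theorems of §2 numerically.
-/

/-- Arithmetic of reading (1): with PARI's value `deg = 3158507520` for de Weger's Frey curve
(`N = 53130`; an UNVERIFIED external computation, j010688), `deg > N²`. -/
example : (53130 : ℕ) ^ 2 < 3158507520 := by norm_num

/-! ## §6 Targets
No line picked yet (`payload.targets = []`, `stuck_stubs = []`); nothing to attack. -/

end Summit.ABC.ABC.Cruxes.FreyDegreeBound.Disproof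

end
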